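import Summits.AtomisticToContinuum.BoseEinsteinCondensation.Theses.BECZeroCrossingDilute
import Summits.AtomisticToContinuum.BoseEinsteinCondensation.Theorems.BECConjugateDominationHardCoreExtensionResidueTower

/-!
# Birth skeleton for the crux `SchemeTransfer` (stmt-AtomisticToContinuum-13906)

Route: `route-AtomisticToContinuum-BECZeroCrossingDilute` (rank-3 crux; sole route wanting it).

Crux (fixed, by name): `SchemeTransfer := NearIsotropicDiluteBEC-body → PeriodicBEC-body`, i.e. the lattice
statement X_IR (half of the exact SU(2) condensate survives in the dilute corner of the easy-plane XXZ
ferromagnet on `(ℤ/Lℤ)³`, stmt-13905 verbatim) implies near-minimiser Bose–Einstein condensation in the constant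
mode for the periodic continuum gas of EVERY repulsive finite-range pair potential `v` (hard cores allowed) at all
small densities (the body of stmt-0826/8997 verbatim). The route's own reading: "only the SCHEME transfers, not
the anchor — no lattice-to-continuum limit theorem is claimed"; the intended discharge is "Dyson softening of `v` +
the bounded-deformation scheme re-run with `Y = ρa³`".

LINE `birth` — "soften along the truncation tower, run the scheme only for BOUNDED potentials and only on their
POSITIVE GROUND STATES, return to hard cores and near-minimisers through the landed fixed-volume transfer":

* `stub_schemeTowerBEC` (T, load-bearing, BEC calibre): under the crux's antecedent, for every admissible `v` the
  positive real exact minimisers of the periodic energy of the BOUNDED truncations `min(v, n)` condense in the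
  constant mode at all small densities, with density threshold, fraction and particle-number threshold UNIFORM IN
  THE TRUNCATION HEIGHT `n` (for bounded `v` the tower is eventually constant; for a hard core of radius `a` it is
  the soft-sphere family `n·1_{[0,a]}` — the level-uniformity IS the Dyson-softening content of the crux, stated
  where "bounded deformation of the exactly condensed free gas" is literal: `H = H₀ + Wₙ`, `Wₙ` bounded).
* `stub_lemmaGConnected` (G): dilute hard-sphere configuration-space connectivity on the torus, eventually in `N`
  (Baryshnikov–Bubenik–Kahle IMRN 2014 §6 — OPEN in print; typed verbatim as `LemmaGConnected` of
  `Cruxes/HardCoreExtension/Disproof.lean` §13 and of the landed `…ResidueTower.lean`).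
* `stub_essExoticTruncationGap` (Γ_ess): a level-uniform dilute Ky Fan gap of the truncations for the
  "essential exotic" admissible non-integrable potentials (no admissible a.e.-modification bounded, locally
  bounded on `(0,∞)` or of the hard-core class) — the residue of the crux's `∀ measurable v` quantifier; no
  physical potential is in this class (verbatim the hypothesis of the landed `uniformTruncationKyFanGap_of_lemmaG_of_essGap`).
* `SchemeTransfer_of : Goal.stub_schemeTowerBEC → Goal.stub_lemmaGConnected → Goal.stub_essExoticTruncationGap →
  SchemeTransfer` (hypotheses = the three stub statements under their audit names `Goal.stub_*`, verbatim copies;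
  no `sorry` of its own) — kernel-checked over the LANDED fixed-volume machinery of crux `HardCoreExtension`
  (stmt-11786, leads c5–c7): `periodicBEC_of_truncationTowerBEC` (tower BEC + uniform
  truncation gap ⇒ near-minimiser periodic BEC of `v`: Ruelle finiteness, truncation energy convergence,
  Faris–Simon/Feynman–Kac simplicity, `2N`-Lipschitz stability of `n₀`, Simon's maximal = minimal form) and
  `uniformTruncationKyFanGap_of_lemmaG_of_essGap` (G + Γ_ess ⇒ the gap for every admissible non-integrable `v`;
  bounded / locally bounded classes unconditional). Concludes the route decl BY NAME.
* `SchemeTransfer_proof : SchemeTransfer := SchemeTransfer_of stub_… stub_… stub_…` — registration form for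
  `ledger skeleton check` and the guard that the `Goal.stub_*` copies are the stub types (uses the sorried stubs; NOT a proof).
-/

namespace Summit.AtomisticToContinuum.BoseEinsteinCondensation.Cruxes.SchemeTransfer.Birth

open MeasureTheory Filter
open Literature.MathematicalPhysics.QuantumManyBody.BoseGas
open Summit.AtomisticToContinuum.BoseEinsteinCondensation.Cruxes.HardCoreExtension.ThirdLawCurrentFloorAlt

/-! ## The stubs (the ONLY `sorry`s of this file) -/

/-- **T — `stub_schemeTowerBEC` (truncation-tower minimiser BEC under the lattice antecedent; load-bearing).**
Assuming the route's rank-2 crux `NearIsotropicDiluteBEC` (the antecedent of `SchemeTransfer`, by name): for every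
repulsive finite-range `v` there is `ρ₀ > 0` such that for `0 < ρ < ρ₀` some `c > 0` bounds
`n₀(Ψ) ≥ c N` for all large `N`, EVERY truncation height `n : ℕ` and every positive real exact minimiser `Ψ` of the
periodic `N`-body energy of the bounded potential `min(v, n)` on the torus of side `(N/ρ)^{1/3}`. Ground-state
currency (no energy slack: honours the Galilean-boost obstruction to slack-robust constant-mode bounds), bounded
potentials only (the softened gas), constants level-uniform (the softening limit commutes with `N → ∞`). Size:
open-problem (thermodynamic-limit BEC, LSSY2005 Ch. 5), i.e. the crux's own calibre minus all fixed-volume analysis.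
The antecedent is carried verbatim from the crux; no lattice-to-continuum theorem makes it bite (route text). -/
theorem stub_schemeTowerBEC :
    Summit.AtomisticToContinuum.BoseEinsteinCondensation.Theses.BECZeroCrossingDilute.NearIsotropicDiluteBEC →
    ∀ v : ℝ → ENNReal, Literature.MathematicalPhysics.QuantumManyBody.BoseGas.IsRepulsiveFiniteRange v →
      ∃ ρ₀ : ℝ, 0 < ρ₀ ∧ ∀ ρ : ℝ, 0 < ρ → ρ < ρ₀ → ∃ c : ℝ, 0 < c ∧
      ∀ᶠ N : ℕ in Filter.atTop, ∀ n : ℕ,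
        ∀ Ψ : Literature.MathematicalPhysics.QuantumManyBody.BoseGas.PeriodicTrialState N
          (Literature.MathematicalPhysics.QuantumManyBody.BoseGas.sideLength ρ N),
        Literature.MathematicalPhysics.QuantumManyBody.BoseGas.periodicEnergy (fun r => min (v r) (n : ENNReal)) Ψ =
          Literature.MathematicalPhysics.QuantumManyBody.BoseGas.periodicGroundStateEnergy
            (fun r => min (v r) (n : ENNReal)) N
            (Literature.MathematicalPhysics.QuantumManyBody.BoseGas.sideLength ρ N) →
        Literature.MathematicalPhysics.QuantumManyBody.BoseGas.periodicEnergy (fun r => min (v r) (n : ENNReal)) Ψ ≠ ⊤ →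
        (∀ X, Ψ.ψ X = (‖Ψ.ψ X‖ : ℂ)) → (∀ X, Ψ.ψ X ≠ 0) →
        ENNReal.ofReal (c * N) ≤
          Literature.MathematicalPhysics.QuantumManyBody.BoseGas.condensateOccupation N
            (Literature.MathematicalPhysics.QuantumManyBody.BoseGas.sideLength ρ N) Ψ.ψ := by
  sorry

/-- **G — `stub_lemmaGConnected` (dilute hard-sphere connectivity on the torus, eventually in `N`).** For every
exclusion distance `b > 0` there is `ρ₁ > 0` such that for `0 < ρ < ρ₁` and all large `N`, any two configurations of
`N` points on the torus of side `(N/ρ)^{1/3}` with all periodic-image pair distances `> b` are joined, after a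
relabelling of the second, by a path of such configurations. OPEN in print (Baryshnikov–Bubenik–Kahle, IMRN 2014,
§6; assumed as (2.1.1) by Simányi, AHP 2004); typed verbatim as in `Cruxes/HardCoreExtension/Disproof.lean` §13 /
`…ResidueTower.lean`. It is what makes the dilute hard-core ground state simple (Perron–Frobenius on a connected
free region), hence the truncation Ky Fan gap level-uniform for the hard-core class. Size: open problem (discrete
geometry), plausibly true. -/
theorem stub_lemmaGConnected :
    ∀ b : ℝ, 0 < b → ∃ ρ₁ : ℝ, 0 < ρ₁ ∧ ∀ ρ : ℝ, 0 < ρ → ρ < ρ₁ → ∀ᶠ N : ℕ in Filter.atTop,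
      ∀ X ∈ {X : Literature.MathematicalPhysics.QuantumManyBody.BoseGas.Config N | ∀ i j : Fin N, i ≠ j →
          ∀ n : Fin 3 → ℤ, b < ‖X i - X j -
            Literature.MathematicalPhysics.QuantumManyBody.BoseGas.latticeVec
              (Literature.MathematicalPhysics.QuantumManyBody.BoseGas.sideLength ρ N) n‖},
        ∀ Y ∈ {X : Literature.MathematicalPhysics.QuantumManyBody.BoseGas.Config N | ∀ i j : Fin N, i ≠ j →
          ∀ n : Fin 3 → ℤ, b < ‖X i - X j -
            Literature.MathematicalPhysics.QuantumManyBody.BoseGas.latticeVec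
              (Literature.MathematicalPhysics.QuantumManyBody.BoseGas.sideLength ρ N) n‖},
          ∃ σ : Equiv.Perm (Fin N),
            JoinedIn {X : Literature.MathematicalPhysics.QuantumManyBody.BoseGas.Config N | ∀ i j : Fin N, i ≠ j →
              ∀ n : Fin 3 → ℤ, b < ‖X i - X j -
                Literature.MathematicalPhysics.QuantumManyBody.BoseGas.latticeVec
                  (Literature.MathematicalPhysics.QuantumManyBody.BoseGas.sideLength ρ N) n‖} X (Y ∘ σ) := by
  sorry

/-- **Γ_ess — `stub_essExoticTruncationGap` (level-uniform dilute truncation Ky Fan gap on the essential exotic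
class).** For an admissible NON-integrable `v` none of whose admissible a.e.-modifications `w` is bounded, locally
bounded on `(0,∞)` or of the hard-core class (`⊤` on `[0,a)`, bounded beyond every `a' > a`), there is `ρ₁ > 0` such
that for `0 < ρ < ρ₁`, eventually in `N`, some `γ > 0` and `n₀` give
`2·E₀(min(v,n)) + γ ≤ kyFanTwo (min(v,n))` on the torus of side `(N/ρ)^{1/3}` for all `n ≥ n₀`. The residue of the
crux's `∀ measurable v` quantifier: no physical potential lies in this class (walls on fat Cantor sets of radii and
the like); verbatim the Γ_ess hypothesis of the landed `uniformTruncationKyFanGap_of_lemmaG_of_essGap`. Size: M–L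
on paper for any concrete member (energetic selection of the outermost free component + G-type connectivity),
artefact-grade as a class. -/
theorem stub_essExoticTruncationGap :
    ∀ v : ℝ → ENNReal, Literature.MathematicalPhysics.QuantumManyBody.BoseGas.IsRepulsiveFiniteRange v →
      (∫⁻ x : Literature.MathematicalPhysics.QuantumManyBody.BoseGas.Space, v ‖x‖) = ⊤ →
      (∀ w : ℝ → ENNReal, Literature.MathematicalPhysics.QuantumManyBody.BoseGas.IsRepulsiveFiniteRange w →
        (∀ᵐ x : Literature.MathematicalPhysics.QuantumManyBody.BoseGas.Space, v ‖x‖ = w ‖x‖) →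
        (¬ ∃ C : NNReal, ∀ r : ℝ, 0 ≤ r → w r ≤ C) ∧
        (¬ ∀ δ : ℝ, 0 < δ → ∃ M : ENNReal, M ≠ ⊤ ∧ ∀ r : ℝ, δ < r → w r ≤ M) ∧
        (¬ ∃ a : ℝ, 0 < a ∧ (∀ r : ℝ, 0 ≤ r → r < a → w r = ⊤) ∧
          ∀ a' : ℝ, a < a' → ∃ M : ENNReal, M ≠ ⊤ ∧ ∀ r : ℝ, a' < r → w r ≤ M)) →
      ∃ ρ₁ : ℝ, 0 < ρ₁ ∧ ∀ ρ : ℝ, 0 < ρ → ρ < ρ₁ → ∀ᶠ N : ℕ in Filter.atTop,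
        ∃ γ : ℝ, 0 < γ ∧ ∃ n₀ : ℕ, ∀ n : ℕ, n₀ ≤ n →
          2 * Literature.MathematicalPhysics.QuantumManyBody.BoseGas.periodicGroundStateEnergy
                (fun r => min (v r) (n : ENNReal)) N
                (Literature.MathematicalPhysics.QuantumManyBody.BoseGas.sideLength ρ N) +
              ENNReal.ofReal γ ≤
            Literature.MathematicalPhysics.QuantumManyBody.BoseGas.kyFanTwo (fun r => min (v r) (n : ENNReal)) N
              (Literature.MathematicalPhysics.QuantumManyBody.BoseGas.sideLength ρ N) := by
  sorry

/-! ## Audit names of the stub statements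

`Goal.stub_x : Prop` is VERBATIM the statement of the registered stub `stub_x` above, so that the skeleton audit
(`#h21_check_skeleton`, by-name policy on hypothesis heads) reads the hypotheses of `SchemeTransfer_of` as exactly the
three declared stubs; `SchemeTransfer_proof` below is the kernel-checked guard that the two copies agree. (The `@[stub]`
tag is gate-reserved, hence plain `abbrev`s, as in the accepted `Cruxes/PeriodicBEC/Lines/birth.lean` and
`Cruxes/GroundStateCondensate/Lines/birth.lean`.) -/

namespace Goal

/-- **T** — truncation-tower minimiser BEC for every admissible potential, under the lattice antecedent
`NearIsotropicDiluteBEC` (statement of `stub_schemeTowerBEC`, verbatim). -/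
abbrev stub_schemeTowerBEC : Prop :=
    Summit.AtomisticToContinuum.BoseEinsteinCondensation.Theses.BECZeroCrossingDilute.NearIsotropicDiluteBEC →
    ∀ v : ℝ → ENNReal, Literature.MathematicalPhysics.QuantumManyBody.BoseGas.IsRepulsiveFiniteRange v →
      ∃ ρ₀ : ℝ, 0 < ρ₀ ∧ ∀ ρ : ℝ, 0 < ρ → ρ < ρ₀ → ∃ c : ℝ, 0 < c ∧
      ∀ᶠ N : ℕ in Filter.atTop, ∀ n : ℕ,
        ∀ Ψ : Literature.MathematicalPhysics.QuantumManyBody.BoseGas.PeriodicTrialState N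
          (Literature.MathematicalPhysics.QuantumManyBody.BoseGas.sideLength ρ N),
        Literature.MathematicalPhysics.QuantumManyBody.BoseGas.periodicEnergy (fun r => min (v r) (n : ENNReal)) Ψ =
          Literature.MathematicalPhysics.QuantumManyBody.BoseGas.periodicGroundStateEnergy
            (fun r => min (v r) (n : ENNReal)) N
            (Literature.MathematicalPhysics.QuantumManyBody.BoseGas.sideLength ρ N) →
        Literature.MathematicalPhysics.QuantumManyBody.BoseGas.periodicEnergy (fun r => min (v r) (n : ENNReal)) Ψ ≠ ⊤ →
        (∀ X, Ψ.ψ X = (‖Ψ.ψ X‖ : ℂ)) → (∀ X, Ψ.ψ X ≠ 0) →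
        ENNReal.ofReal (c * N) ≤
          Literature.MathematicalPhysics.QuantumManyBody.BoseGas.condensateOccupation N
            (Literature.MathematicalPhysics.QuantumManyBody.BoseGas.sideLength ρ N) Ψ.ψ

/-- **G** — dilute hard-sphere configuration-space connectivity on the torus, eventually in `N` (statement of
`stub_lemmaGConnected`, verbatim; = `LemmaGConnected` of `Cruxes/HardCoreExtension/Disproof.lean` §13). -/
abbrev stub_lemmaGConnected : Prop :=
    ∀ b : ℝ, 0 < b → ∃ ρ₁ : ℝ, 0 < ρ₁ ∧ ∀ ρ : ℝ, 0 < ρ → ρ < ρ₁ → ∀ᶠ N : ℕ in Filter.atTop,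
      ∀ X ∈ {X : Literature.MathematicalPhysics.QuantumManyBody.BoseGas.Config N | ∀ i j : Fin N, i ≠ j →
          ∀ n : Fin 3 → ℤ, b < ‖X i - X j -
            Literature.MathematicalPhysics.QuantumManyBody.BoseGas.latticeVec
              (Literature.MathematicalPhysics.QuantumManyBody.BoseGas.sideLength ρ N) n‖},
        ∀ Y ∈ {X : Literature.MathematicalPhysics.QuantumManyBody.BoseGas.Config N | ∀ i j : Fin N, i ≠ j →
          ∀ n : Fin 3 → ℤ, b < ‖X i - X j -
            Literature.MathematicalPhysics.QuantumManyBody.BoseGas.latticeVec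
              (Literature.MathematicalPhysics.QuantumManyBody.BoseGas.sideLength ρ N) n‖},
          ∃ σ : Equiv.Perm (Fin N),
            JoinedIn {X : Literature.MathematicalPhysics.QuantumManyBody.BoseGas.Config N | ∀ i j : Fin N, i ≠ j →
              ∀ n : Fin 3 → ℤ, b < ‖X i - X j -
                Literature.MathematicalPhysics.QuantumManyBody.BoseGas.latticeVec
                  (Literature.MathematicalPhysics.QuantumManyBody.BoseGas.sideLength ρ N) n‖} X (Y ∘ σ)

/-- **Γ_ess** — level-uniform dilute truncation Ky Fan gap on the essential exotic non-integrable class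
(statement of `stub_essExoticTruncationGap`, verbatim). -/
abbrev stub_essExoticTruncationGap : Prop :=
    ∀ v : ℝ → ENNReal, Literature.MathematicalPhysics.QuantumManyBody.BoseGas.IsRepulsiveFiniteRange v →
      (∫⁻ x : Literature.MathematicalPhysics.QuantumManyBody.BoseGas.Space, v ‖x‖) = ⊤ →
      (∀ w : ℝ → ENNReal, Literature.MathematicalPhysics.QuantumManyBody.BoseGas.IsRepulsiveFiniteRange w →
        (∀ᵐ x : Literature.MathematicalPhysics.QuantumManyBody.BoseGas.Space, v ‖x‖ = w ‖x‖) →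
        (¬ ∃ C : NNReal, ∀ r : ℝ, 0 ≤ r → w r ≤ C) ∧
        (¬ ∀ δ : ℝ, 0 < δ → ∃ M : ENNReal, M ≠ ⊤ ∧ ∀ r : ℝ, δ < r → w r ≤ M) ∧
        (¬ ∃ a : ℝ, 0 < a ∧ (∀ r : ℝ, 0 ≤ r → r < a → w r = ⊤) ∧
          ∀ a' : ℝ, a < a' → ∃ M : ENNReal, M ≠ ⊤ ∧ ∀ r : ℝ, a' < r → w r ≤ M)) →
      ∃ ρ₁ : ℝ, 0 < ρ₁ ∧ ∀ ρ : ℝ, 0 < ρ → ρ < ρ₁ → ∀ᶠ N : ℕ in Filter.atTop,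
        ∃ γ : ℝ, 0 < γ ∧ ∃ n₀ : ℕ, ∀ n : ℕ, n₀ ≤ n →
          2 * Literature.MathematicalPhysics.QuantumManyBody.BoseGas.periodicGroundStateEnergy
                (fun r => min (v r) (n : ENNReal)) N
                (Literature.MathematicalPhysics.QuantumManyBody.BoseGas.sideLength ρ N) +
              ENNReal.ofReal γ ≤
            Literature.MathematicalPhysics.QuantumManyBody.BoseGas.kyFanTwo (fun r => min (v r) (n : ENNReal)) N
              (Literature.MathematicalPhysics.QuantumManyBody.BoseGas.sideLength ρ N)

end Goal

/-! ## The composition -/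

/-- **Assembly of the line: T → G → Γ_ess → `SchemeTransfer`** (the route decl, by name; no `sorry` of its own;
hypotheses are the three declared stubs by their audit names `Goal.stub_*`, verbatim the stub statements). Given
the antecedent `hA` (lattice X_IR) and an admissible `v`: T (fed with `hA`) is truncation-tower minimiser BEC of `v`; G and Γ_ess give, through the landed
`uniformTruncationKyFanGap_of_lemmaG_of_essGap`, the level-uniform truncation Ky Fan gap of `v` whenever `v` is
non-integrable (bounded / locally-bounded / hard-core-mod-G classes are handled inside that landed theorem); the
landed transfer `periodicBEC_of_truncationTowerBEC` (crux `HardCoreExtension`, stmt-11786: Ruelle finiteness,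
truncation energy convergence, Faris–Simon / Feynman–Kac simplicity, `2N`-Lipschitz `n₀`-stability, Simon's
maximal = minimal form — all kernel-checked in `Theorems/BECConjugateDominationHardCoreExtension*.lean`) returns
exactly the consequent of the crux for `v`: near-minimiser constant-mode BEC on the torus of side `(N/ρ)^{1/3}`
at all small `ρ`, fraction halved. -/
theorem SchemeTransfer_of :
    Goal.stub_schemeTowerBEC → Goal.stub_lemmaGConnected → Goal.stub_essExoticTruncationGap →
    Summit.AtomisticToContinuum.BoseEinsteinCondensation.Theses.BECZeroCrossingDilute.SchemeTransfer := by
  intro hT hG hΓ hA v hv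
  exact periodicBEC_of_truncationTowerBEC v hv (hT hA v hv)
    (uniformTruncationKyFanGap_of_lemmaG_of_essGap hG hΓ v hv)

/-- **Registration form**: the crux decl BY NAME from `SchemeTransfer_of` and the three sorried stubs (each stub
theorem inhabits its `Goal.stub_*` audit name definitionally — the guard that the two verbatim copies agree). It
USES the stubs and is therefore NOT a proof of the crux — only the certificate that the stubs compose to it. -/
theorem SchemeTransfer_proof :
    Summit.AtomisticToContinuum.BoseEinsteinCondensation.Theses.BECZeroCrossingDilute.SchemeTransfer :=
  SchemeTransfer_of stub_schemeTowerBEC stub_lemmaGConnected stub_essExoticTruncationGap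

end Summit.AtomisticToContinuum.BoseEinsteinCondensation.Cruxes.SchemeTransfer.Birth
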